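import Summits.AtomisticToContinuum.Crystallization.Theses.PalmUnimodularRigidity
import Literature.Geometry.DiscreteGeometry.KissingRigidity

/-!
# Sketch — crux `ShellsToBarlowChart` (stmt-AtomisticToContinuum-9227), ideator 1 (gen 2), round 1

First-lemma signatures for the idea card `link-recognition`
("after `margins`, forget ℝ³: the bond graph is ABSTRACTLY locally-{cuboctahedron, anticuboctahedron};
local recognition of that graph class is finite and certified at radius 2; ℝ³ re-enters once, to kill the deck group").

* `cuboGraph`, `anticuboGraph` : the two link graphs on `Fin 12`, from the tree's integer tables
  (`fccAdj`, `hcpAdj` of `KissingRigidity.lean`).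
* `IsLocallyBarlow G`          : every vertex link of the abstract simple graph `G` is (induced-)isomorphic to one of them.
* `windowGraph S`               : the bond graph of `S ⊆ ℝ³` (pairs at distance in `(0, 28/25]`), on the subtype `S`.
* `LinksExact`                  : RADIUS-1 lemma (size M, from the disprover's `margins` + unpacking `ShellCloseTo`):
                                  every-point-good `S` has a locally-Barlow window graph.
* `WindowConnected`             : the window graph of a non-empty every-point-good `S` is connected (Delone + exclusivity).
* `LocallyBarlowRecognition`    : THE TRANSFER TARGET, pure combinatorics + explicit model coordinates: a connected
                                  locally-Barlow graph is star-bijectively covered by the contact graph of an ideal Barlow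
                                  stacking, and the cover is injective unless a fixed-point-free isometry of the stacking
                                  commutes with it (a deck transformation).
* `NoDeckIsometryInSpace`       : the ONLY other use of ℝ³ (the closer shared with cards holonomy-growth-dichotomy /
                                  develop-the-model-growth-descent): no deck transformation when the covered graph is the
                                  window graph of an every-point-good set (fixed point ⇒ short orbit; translation ⇒
                                  quadratic growth against cubic growth of a Delone set).
* `shellsToBarlowChart_of_recognition` : the four compose to the crux BY NAME — PROVED below (no sorry).
* `EquatorPropagates`, `CapsAreLevel`  : two of the radius-≤2 local lemmas in ABSTRACT form (statements only); both are
                                  instances of the certified radius-2 classification (toy/amalgam.py: the free amalgam of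
                                  the 13 exact links around a vertex is one of exactly 6 Barlow 2-balls).
-/

namespace Summit.AtomisticToContinuum.Crystallization.Cruxes.ShellsToBarlowChart.LinkRecognitionSketch

open Literature.Geometry.DiscreteGeometry Literature.MathematicalPhysics.StatisticalMechanics
open scoped Classical

/-- Euclidean `3`-space. -/
local notation "E3" => EuclideanSpace ℝ (Fin 3)

/-! ## The two link graphs and the abstract graph class -/

/-- The cuboctahedron graph (FCC kissing-pattern contact graph) on `Fin 12`, from the tree table `fccTab`. -/
def cuboGraph : SimpleGraph (Fin 12) := SimpleGraph.fromRel fun i j => fccAdj i j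

/-- The anticuboctahedron graph `J27` (HCP contact graph) on `Fin 12`, from `hcpTab`
(indices `0–5` equator, `6–8` upper triangle, `9–11` lower triangle). -/
def anticuboGraph : SimpleGraph (Fin 12) := SimpleGraph.fromRel fun i j => hcpAdj i j

/-- An abstract simple graph is LOCALLY BARLOW if the subgraph induced on every vertex neighbourhood is
isomorphic to the cuboctahedron graph or to the anticuboctahedron graph. -/
def IsLocallyBarlow {V : Type*} (G : SimpleGraph V) : Prop :=
  ∀ v : V, Nonempty (G.induce (G.neighborSet v) ≃g cuboGraph) ∨
    Nonempty (G.induce (G.neighborSet v) ≃g anticuboGraph)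

/-! ## The crux hypothesis and the window graph -/

/-- The crux hypothesis at one point with an explicit scale `a` (verbatim shape). -/
def GoodShellAt (S : Set E3) (x : E3) (a : ℝ) : Prop :=
  ∃ T : Finset E3, (↑T : Set E3) = (fun y : E3 => y - x) '' {y : E3 | y ∈ S ∧ y ≠ x ∧ dist y x ≤ 5 / 4 * a} ∧
    (ShellCloseTo (a / 100) T (Finset.image (fun v : E3 => a • v) fccKissingPattern) ∨
     ShellCloseTo (a / 100) T (Finset.image (fun v : E3 => a • v) hcpKissingPattern))

/-- The crux hypothesis, verbatim shape: every point has a `1 %`-good shell at its own scale. -/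
def EveryPointGood (S : Set E3) : Prop :=
  ∀ x ∈ S, ∃ a : ℝ, 9 / 10 ≤ a ∧ a ≤ 1 ∧ GoodShellAt S x a

/-- The WINDOW (bond) graph of `S`: pairs at distance in `(0, 28/25]`, as a simple graph on the subtype `S`. -/
def windowGraph (S : Set E3) : SimpleGraph S :=
  SimpleGraph.fromRel fun x y : S => 0 < dist (x : E3) y ∧ dist (x : E3) y ≤ 28 / 25

/-- RADIUS-1 LEMMA (size M): the window graph of an every-point-good set is locally Barlow.
Content: the disprover's four `margins` (window graph = shell graph; pattern-adjacent shell points are `≤ 1.02a`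
apart, non-adjacent ones `≥ 1.2548`) and `card_eq_twelve_of_shellCloseTo`; the isomorphism is the matching bijection
of `ShellCloseTo` composed with the enumeration `fccTab`/`hcpTab`. -/
def LinksExact : Prop := ∀ S : Set E3, EveryPointGood S → IsLocallyBarlow (windowGraph S)

/-- The window graph of a non-empty every-point-good set is connected (covering radius `< 0.8`, hard core `0.89`:
a nearest pair of two components would violate exclusivity). -/
def WindowConnected : Prop := ∀ S : Set E3, S.Nonempty → EveryPointGood S → (windowGraph S).Connected

/-! ## The transfer target: local recognition of locally-Barlow graphs (pure combinatorics + model coordinates) -/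

/-- `Ψ` is a STAR-BIJECTIVE BARLOW COVER of the abstract graph `G` by the contact graph of the ideal stacking with
Hägg word `s`: onto, unit contacts go to edges, and the twelve contacts of every stacking point go bijectively onto the
neighbourhood of its image. -/
def IsBarlowCoverOf {V : Type*} (G : SimpleGraph V) (s : ℤ → ℤ) (Ψ : E3 → V) : Prop :=
  Set.SurjOn Ψ (barlowStacking 1 (Real.sqrt (2 / 3)) s) Set.univ ∧
  (∀ p ∈ barlowStacking 1 (Real.sqrt (2 / 3)) s, ∀ q ∈ barlowStacking 1 (Real.sqrt (2 / 3)) s,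
      dist p q = 1 → G.Adj (Ψ p) (Ψ q)) ∧
  (∀ p ∈ barlowStacking 1 (Real.sqrt (2 / 3)) s,
      Set.BijOn Ψ {q : E3 | q ∈ barlowStacking 1 (Real.sqrt (2 / 3)) s ∧ dist p q = 1} (G.neighborSet (Ψ p)))

/-- A DECK TRANSFORMATION of the cover: a fixed-point-free isometry of `ℝ³` preserving the stacking and commuting
with `Ψ`. -/
def HasDeckIsometry (s : ℤ → ℤ) {V : Type*} (Ψ : E3 → V) : Prop :=
  ∃ g : E3 ≃ᵢ E3, g '' barlowStacking 1 (Real.sqrt (2 / 3)) s = barlowStacking 1 (Real.sqrt (2 / 3)) s ∧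
    (∀ p ∈ barlowStacking 1 (Real.sqrt (2 / 3)) s, g p ≠ p) ∧
    ∀ p ∈ barlowStacking 1 (Real.sqrt (2 / 3)) s, Ψ (g p) = Ψ p

/-- **LOCAL RECOGNITION** (the Transfer `C⁺`, tolerance-free and ℝ³-free): every connected locally-Barlow graph is
star-bijectively covered by an ideal Barlow stacking, injectively unless there is a deck transformation.  Proof plan:
radius-2 classification of free amalgams (certified: 6 types, all Barlow) ⇒ sheet-and-stack development of the MODEL
into `G` by path lifting on `ℤ²` layers and on the layer index (all monodromy questions asked in the model, where they
are explicit-coordinate facts) ⇒ `Ψ`; `K(B_s)` (triangles + octahedron squares) combinatorially simply connected ⇒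
the cover is regular ⇒ a non-injective `Ψ` has a deck transformation, realised by an isometry (stars are rigid). -/
def LocallyBarlowRecognition : Prop :=
  ∀ (V : Type) (G : SimpleGraph V), Nonempty V → G.Connected → IsLocallyBarlow G →
    ∃ s : ℤ → ℤ, IsHaggSeq s ∧ ∃ Ψ : E3 → V, IsBarlowCoverOf G s Ψ ∧
      (Set.InjOn Ψ (barlowStacking 1 (Real.sqrt (2 / 3)) s) ∨ HasDeckIsometry s Ψ)

/-- **THE CLOSER** (shared with cards holonomy-growth-dichotomy / develop-the-model-growth-descent; the only use of the
embedding beyond `margins`): a star-bijective Barlow cover of the window graph of an every-point-good `S ⊆ ℝ³` has no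
deck transformation — a deck isometry of finite order fixes a point and moves a nearby stacking point by graph distance
`≤ 2` (fibres are `3`-sparse), one of infinite order yields a translation and quadratic growth of `S`'s bond graph,
against cubic growth (hard core `0.89`, covering radius `≤ 3/4`). -/
def NoDeckIsometryInSpace : Prop :=
  ∀ S : Set E3, EveryPointGood S → ∀ s : ℤ → ℤ, IsHaggSeq s → ∀ Ψ : E3 → S,
    IsBarlowCoverOf (windowGraph S) s Ψ → ¬ HasDeckIsometry s Ψ

/-- The window relation is symmetric, so adjacency in `windowGraph S` is exactly "distinct and in the window". -/
theorem windowGraph_adj {S : Set E3} {x y : S} :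
    (windowGraph S).Adj x y ↔ 0 < dist (x : E3) y ∧ dist (x : E3) y ≤ 28 / 25 := by
  rw [windowGraph, SimpleGraph.fromRel_adj]
  constructor
  · rintro ⟨-, h | h⟩
    · exact h
    · rwa [dist_comm] at h
  · intro h
    refine ⟨?_, Or.inl h⟩
    intro hxy
    have : dist (x : E3) y = 0 := by rw [hxy, dist_self]
    linarith [h.1]

/-- **The line composes to the crux, by name.** -/
theorem shellsToBarlowChart_of_recognition (h₁ : LinksExact) (h₂ : WindowConnected)
    (h₃ : LocallyBarlowRecognition) (h₄ : NoDeckIsometryInSpace) :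
    Summit.AtomisticToContinuum.Crystallization.Theses.PalmUnimodularRigidity.ShellsToBarlowChart := by
  intro S hne hgood
  have hgood' : EveryPointGood S := by
    intro x hx
    obtain ⟨a, ha1, ha2, T, hT, hclose⟩ := hgood x hx
    exact ⟨a, ha1, ha2, T, hT, hclose⟩
  haveI : Nonempty S := hne.to_subtype
  obtain ⟨s, hs, Ψ, hcov, hinj⟩ := h₃ S (windowGraph S) inferInstance (h₂ S hne hgood') (h₁ S hgood')
  have hinj' : Set.InjOn Ψ (barlowStacking 1 (Real.sqrt (2 / 3)) s) :=
    hinj.resolve_right (h₄ S hgood' s hs Ψ hcov)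
  obtain ⟨hsurj, hbond, hstar⟩ := hcov
  refine ⟨s, hs, fun p => (Ψ p : E3), ⟨fun p _ => (Ψ p).2, ?_, ?_⟩, ?_⟩
  · intro p hp q hq hpq
    exact hinj' hp hq (Subtype.ext hpq)
  · intro y hy
    obtain ⟨p, hp, hpy⟩ := hsurj (Set.mem_univ (⟨y, hy⟩ : S))
    exact ⟨p, hp, by show ((Ψ p : S) : E3) = y; rw [hpy]⟩
  · intro p hp q hq
    constructor
    · intro hd
      exact windowGraph_adj.1 (hbond p hp q hq hd)
    · intro hw
      have hadj : (windowGraph S).Adj (Ψ p) (Ψ q) := windowGraph_adj.2 hw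
      have hmem : Ψ q ∈ (windowGraph S).neighborSet (Ψ p) := hadj
      obtain ⟨q', ⟨hq'B, hq'd⟩, hq'eq⟩ := (hstar p hp).surjOn hmem
      have : q' = q := hinj' hq'B hq hq'eq
      rw [← this]; exact hq'd

/-! ## Two radius-≤2 local lemmas in ABSTRACT form (statements; instances of the certified radius-2 classification) -/

/-- **P1, abstract (equator propagation).**  If the link of `v` is the anticuboctahedron via an isomorphism `e`, and
`w` is a neighbour of `v` sitting on the equator (`e w < 6` in the `hcpTab` enumeration), then the link of `w` is the
anticuboctahedron too, via an isomorphism putting `v` on ITS equator.  (Proof: the edge from `v` to the next equator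
point lies in two triangles of link(`w`) — impossible in the cuboctahedron, where every edge lies in exactly one triangle,
and equatorial in `J27`: tree `fcc_range_common_unique`, `hcp_range_common_two` are the `η = 0` versions.) -/
def EquatorPropagates : Prop :=
  ∀ (V : Type) (G : SimpleGraph V), IsLocallyBarlow G → ∀ v w : V, ∀ hw : w ∈ G.neighborSet v,
    ∀ e : G.induce (G.neighborSet v) ≃g anticuboGraph, (e ⟨w, hw⟩ : ℕ) < 6 →
      ∃ e' : G.induce (G.neighborSet w) ≃g anticuboGraph, (e' ⟨v, (G.adj_comm _ _).1 hw⟩ : ℕ) < 6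

/-- **Occupancy / levelness, abstract.**  If `y ∉ N(v)`-equator is a cap over a triangle `{v, w₁, w₂}` of an equatorial
sheet (all three on each other's equators) then, in the link of `y`, the triangle `{v, w₁, w₂}` is a POLAR triangle when
link(`y`) is the anticuboctahedron (so `y`'s equator is the level hexagon): stated as "no isomorphism of link(`y`) with
`J27` sends `v` to the equator".  One of the radius-2 facts read off the six certified free amalgams. -/
def CapsAreLevel : Prop :=
  ∀ (V : Type) (G : SimpleGraph V), IsLocallyBarlow G → ∀ v w₁ w₂ y : V,
    ∀ e : G.induce (G.neighborSet v) ≃g anticuboGraph,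
    ∀ (h₁ : w₁ ∈ G.neighborSet v) (h₂ : w₂ ∈ G.neighborSet v) (hy : y ∈ G.neighborSet v),
      (e ⟨w₁, h₁⟩ : ℕ) < 6 → (e ⟨w₂, h₂⟩ : ℕ) < 6 → G.Adj w₁ w₂ → G.Adj y w₁ → G.Adj y w₂ → 6 ≤ (e ⟨y, hy⟩ : ℕ) →
      ∀ f : G.induce (G.neighborSet y) ≃g anticuboGraph, 6 ≤ (f ⟨v, (G.adj_comm _ _).1 hy⟩ : ℕ)

end Summit.AtomisticToContinuum.Crystallization.Cruxes.ShellsToBarlowChart.LinkRecognitionSketch
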